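import Summits.KontsevichZagierPeriods.KontsevichZagierPeriods.Theorems.SoloInformedKZPOneAlg
import HarnessLib
import HarnessLib.Audit

/-!
# SoloInformed — real algebraic coefficients: lowest terms, boundary poles, and the piece lemma

Solo programme `solo-KontsevichZagierPeriods-informed`, session s112, file 16.

Files 14–15 treat integrands `Re(P/Q)`, `P, Q ∈ ℚ̄[X]`, with `Q` pole-free on the CLOSED piece.
For REAL algebraic coefficients — `P, Q ∈ K[X]`, `K = algebraicClosure ℚ ℝ` the field of real
algebraic numbers — the hypothesis relaxes to KZ's literal shape "`Q ≠ 0` on the (open) domain",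
exactly as for `ℚ`-coefficients: pass to lowest terms over the field `K`
(`soloInformed_lowestTerms_K`) and use that a pole of order `≥ 1` of a coprime fraction is not
integrable (`soloInformed_aeval_ne_zero_of_isCoprime_K`, from `KZ.rootMultiplicity_le_of_integrableOn`),
so the reduced denominator has no zero on the closed piece; then read `K[X]` inside `ℚ̄[X]` by the
ring morphism `soloInformedRealAlgHom : K →+* ℚ̄` and apply the algebraic piece lemma of file 14.

Main result: `soloInformed_restrict_interval_mem_segSpan_K` — for `r` of dimension `1` with
integrand `P/Q` (`P, Q ∈ K[X]`, `Q ≠ 0` on `dom r`) the piece `[(u,v), P/Q]` (`u < v` real algebraic,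
`(u,v) ⊆ dom r`) lies in the span of points and segments.  File 17 assembles the sector theorem.

References: M. Kontsevich, D. Zagier, *Periods* (2001), §1.1; J. Viu-Sos, *A semi-canonical
reduction for periods of Kontsevich–Zagier* (2021), §2.3 (no integrable poles).
-/

noncomputable section

open scoped BigOperators Polynomial

namespace Summit.KontsevichZagierPeriods.KontsevichZagierPeriods.Theorems

open Set MeasureTheory
open Literature.ModelTheory.ExponentialFields
open Literature.NumberTheory.Transcendental Literature.NumberTheory.Transcendental.KZ

/-- Lowest terms over the field `K = algebraicClosure ℚ ℝ` of real algebraic numbers. -/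
theorem soloInformed_lowestTerms_K (P Q : (algebraicClosure ℚ ℝ)[X]) (hQ : Q ≠ 0) :
    IsCoprime (P / GCDMonoid.gcd P Q) (Q / GCDMonoid.gcd P Q) ∧ Q / GCDMonoid.gcd P Q ≠ 0 ∧
    ∀ t : ℝ, (Polynomial.aeval t Q : ℝ) ≠ 0 →
      (Polynomial.aeval t (Q / GCDMonoid.gcd P Q) : ℝ) ≠ 0 ∧
      (Polynomial.aeval t P : ℝ) / Polynomial.aeval t Q =
        Polynomial.aeval t (P / GCDMonoid.gcd P Q) / Polynomial.aeval t (Q / GCDMonoid.gcd P Q) := by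
  set g := GCDMonoid.gcd P Q with hg
  have hg0 : g ≠ 0 := fun h => hQ ((gcd_eq_zero_iff P Q).1 h).2
  have hPg : g * (P / g) = P := EuclideanDomain.mul_div_cancel' hg0 (GCDMonoid.gcd_dvd_left P Q)
  have hQg : g * (Q / g) = Q := EuclideanDomain.mul_div_cancel' hg0 (GCDMonoid.gcd_dvd_right P Q)
  refine ⟨isCoprime_div_gcd_div_gcd hQ, right_div_gcd_ne_zero hQ, fun t ht => ?_⟩
  have hQt : (Polynomial.aeval t Q : ℝ) = Polynomial.aeval t g * Polynomial.aeval t (Q / g) := by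
    conv_lhs => rw [← hQg]
    rw [map_mul]
  have hPt : (Polynomial.aeval t P : ℝ) = Polynomial.aeval t g * Polynomial.aeval t (P / g) := by
    conv_lhs => rw [← hPg]
    rw [map_mul]
  rw [hQt] at ht
  refine ⟨right_ne_zero_of_mul ht, ?_⟩
  rw [hPt, hQt, mul_div_mul_left _ _ (left_ne_zero_of_mul ht)]

/-- **No integrable pole (real algebraic coefficients).** Coprime `P₁, Q₁ ∈ K[X]`, `Q₁ ≠ 0`,
`P₁/Q₁` integrable on `(u, v)`: then `Q₁` has no zero on `[u, v]`. [Viu-Sos 2021, §2.3] -/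
theorem soloInformed_aeval_ne_zero_of_isCoprime_K {P₁ Q₁ : (algebraicClosure ℚ ℝ)[X]}
    (hcop : IsCoprime P₁ Q₁) (hQ₁ : Q₁ ≠ 0) {u v a : ℝ} (huv : u < v) (ha : a ∈ Icc u v)
    (hint : IntegrableOn (fun t : ℝ => (Polynomial.aeval t P₁ : ℝ) / Polynomial.aeval t Q₁)
      (Ioo u v)) :
    (Polynomial.aeval a Q₁ : ℝ) ≠ 0 := by
  have hev : ∀ (F : (algebraicClosure ℚ ℝ)[X]) (t : ℝ), (Polynomial.aeval t F : ℝ) =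
      (F.map (algebraMap (algebraicClosure ℚ ℝ) ℝ)).eval t :=
    fun F t => by rw [Polynomial.eval_map, Polynomial.aeval_def]
  set P := P₁.map (algebraMap (algebraicClosure ℚ ℝ) ℝ) with hP
  set Q := Q₁.map (algebraMap (algebraicClosure ℚ ℝ) ℝ) with hQ
  have hinj : Function.Injective (algebraMap (algebraicClosure ℚ ℝ) ℝ) :=
    (algebraMap (algebraicClosure ℚ ℝ) ℝ).injective
  have hcop' : IsCoprime P Q := by
    simpa only [Polynomial.coe_mapRingHom] using
      hcop.map (Polynomial.mapRingHom (algebraMap (algebraicClosure ℚ ℝ) ℝ))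
  have hQ0 : Q ≠ 0 := fun h => hQ₁ ((Polynomial.map_eq_zero_iff hinj).1 h)
  intro hQa
  rw [hev] at hQa
  by_cases hP0 : P = 0
  · have hP₁ : P₁ = 0 := (Polynomial.map_eq_zero_iff hinj).1 hP0
    rw [hP₁, isCoprime_zero_left] at hcop
    obtain ⟨c, hc, hcQ⟩ := Polynomial.isUnit_iff.1 hcop
    rw [← hcQ, Polynomial.map_C, Polynomial.eval_C] at hQa
    exact hc.ne_zero (hinj (by rw [hQa, map_zero]))
  · have hint' : IntegrableOn (fun t => P.eval t / Q.eval t) (Ioo u v) :=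
      hint.congr_fun (fun t _ => by
        simp only [hP, hQ, hev]) measurableSet_Ioo
    have hle := KZ.rootMultiplicity_le_of_integrableOn hP0 hQ0 huv ha hint'
    have hQpos : 0 < Q.rootMultiplicity a := (Polynomial.rootMultiplicity_pos hQ0).2 hQa
    have hPa : P.eval a = 0 := (Polynomial.rootMultiplicity_pos hP0).1 (hQpos.trans_le hle)
    obtain ⟨s, t, hst⟩ := hcop'
    have h1 := congrArg (Polynomial.eval a) hst
    rw [Polynomial.eval_add, Polynomial.eval_mul, Polynomial.eval_mul, hPa, Polynomial.eval_one]
      at h1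
    have hQa' : Polynomial.eval a Q = 0 := hQa
    rw [hQa'] at h1
    norm_num at h1

/-- The ring morphism `K = algebraicClosure ℚ ℝ → ℚ̄ = algebraicClosure ℚ ℂ`, `k ↦ k` (a real
algebraic number is a complex algebraic number). -/
def soloInformedRealAlgHom : (algebraicClosure ℚ ℝ) →+* (algebraicClosure ℚ ℂ) where
  toFun k := ⟨((k : ℝ) : ℂ), mem_algebraicClosure_iff.2
    (by simpa using (mem_algebraicClosure_iff.1 k.2).algebraMap (A := ℂ))⟩
  map_one' := Subtype.ext (by simp)
  map_mul' x y := Subtype.ext (by simp)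
  map_zero' := Subtype.ext (by simp)
  map_add' x y := Subtype.ext (by simp)

/-- Value of the morphism in `ℂ`. -/
@[simp] theorem soloInformed_realAlgHom_coe (k : algebraicClosure ℚ ℝ) :
    ((soloInformedRealAlgHom k : algebraicClosure ℚ ℂ) : ℂ) = ((k : ℝ) : ℂ) := rfl

/-- Evaluation compatibility: reading `F ∈ K[X]` in `ℚ̄[X]` and then in `ℂ` at a real point gives
the real value `F(t)`. -/
theorem soloInformed_eval_map_realAlgHom (F : (algebraicClosure ℚ ℝ)[X]) (t : ℝ) :
    ((F.map soloInformedRealAlgHom).map (algebraMap (algebraicClosure ℚ ℂ) ℂ)).eval (t : ℂ) =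
      ((Polynomial.aeval t F : ℝ) : ℂ) := by
  have hcomp : (algebraMap (algebraicClosure ℚ ℂ) ℂ).comp soloInformedRealAlgHom =
      (algebraMap ℝ ℂ).comp (algebraMap (algebraicClosure ℚ ℝ) ℝ) := by
    ext k
    rfl
  rw [Polynomial.map_map, hcomp, ← Polynomial.map_map, Polynomial.eval_map,
    ← Complex.coe_algebraMap, Polynomial.eval₂_hom, Polynomial.eval_map, ← Polynomial.aeval_def]

/-- The real rational function `P/Q`, `P, Q ∈ K[X]`, is `Re(P/Q)` read in `ℚ̄[X]`. -/
theorem soloInformed_algFun_map_realAlgHom (P Q : (algebraicClosure ℚ ℝ)[X]) (y : Fin 1 → ℝ) :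
    soloInformedAlgFun (P.map soloInformedRealAlgHom) (Q.map soloInformedRealAlgHom) y =
      (Polynomial.aeval (y 0) P : ℝ) / Polynomial.aeval (y 0) Q := by
  unfold soloInformedAlgFun
  rw [soloInformed_eval_map_realAlgHom, soloInformed_eval_map_realAlgHom, ← Complex.ofReal_div,
    Complex.ofReal_re]

/-- **PIECE LEMMA over real algebraic coefficients, poles on the boundary allowed.** For `r` of
dimension `1` with integrand `P/Q` on its domain (`P, Q ∈ K[X]`, `Q ≠ 0` on `dom r`) and an interval
`(u, v) ⊆ dom r` with real algebraic endpoints, the piece `[(u, v), P/Q]` lies in the span of points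
and segments. [Kontsevich–Zagier 2001, §1.1–1.2; Viu-Sos 2021, §2.3; this work] -/
theorem soloInformed_restrict_interval_mem_segSpan_K (r : IntegralRep 1)
    {P Q : (algebraicClosure ℚ ℝ)[X]}
    (hq : ∀ x ∈ r.domain, (Polynomial.aeval (x 0) Q : ℝ) ≠ 0)
    (hpq : EqOn r.integrand
      (fun x => (Polynomial.aeval (x 0) P : ℝ) / Polynomial.aeval (x 0) Q) r.domain)
    {u v : ℝ} (huv : u < v) (hu : IsAlgebraic ℚ u) (hv : IsAlgebraic ℚ v)
    (hI : IsSemialgebraic ℚ {w : Fin 1 → ℝ | ∀ i, u < w i ∧ w i < v})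
    (hsub : {w : Fin 1 → ℝ | ∀ i, u < w i ∧ w i < v} ⊆ r.domain) :
    of (r.restrict _ hI hsub) ∈ soloInformedSegSpan := by
  classical
  /- Step 0: lowest terms, `Q₁ ≠ 0` on `[u, v]`. -/
  obtain ⟨x₀, hx₀⟩ : ∃ x₀ : Fin 1 → ℝ, x₀ ∈ {w : Fin 1 → ℝ | ∀ i, u < w i ∧ w i < v} :=
    ⟨fun _ => (u + v) / 2, fun i => ⟨by linarith, by linarith⟩⟩
  have hQ0 : Q ≠ 0 := by
    intro h
    apply hq x₀ (hsub hx₀)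
    rw [h, map_zero]
  obtain ⟨hcop, hQ₁0, hred⟩ := soloInformed_lowestTerms_K P Q hQ0
  set P₁ := P / GCDMonoid.gcd P Q with hP₁
  set Q₁ := Q / GCDMonoid.gcd P Q with hQ₁
  have hQt : ∀ t ∈ Ioo u v, (Polynomial.aeval t Q : ℝ) ≠ 0 := fun t ht =>
    hq (fun _ => t) (hsub fun i => ht)
  have hint : IntegrableOn (fun t : ℝ => (Polynomial.aeval t P₁ : ℝ) / Polynomial.aeval t Q₁)
      (Ioo u v) := by
    set e : ℝ → (Fin 1 → ℝ) := fun t _ => t with he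
    set Φ₁ := MeasurableEquiv.funUnique (Fin 1) ℝ with hΦ₁
    have hΦe : ⇑Φ₁.symm = e := by
      funext t i
      rw [hΦ₁, MeasurableEquiv.funUnique_symm_apply]
      exact uniqueElim_const t i
    have h := ((volume_preserving_funUnique (Fin 1) ℝ).symm Φ₁).integrableOn_comp_preimage
      Φ₁.symm.measurableEmbedding (f := r.integrand) (s := r.domain)
    rw [hΦe] at h
    have hA : IntegrableOn (r.integrand ∘ e) (e ⁻¹' r.domain) := h.mpr r.integrableOn
    have hsubA : Ioo u v ⊆ e ⁻¹' r.domain := fun t ht => hsub fun i => ht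
    refine (hA.mono_set hsubA).congr_fun (fun t ht => ?_) measurableSet_Ioo
    have hmem : e t ∈ r.domain := hsubA ht
    show r.integrand (e t) = _
    rw [hpq hmem]
    show (Polynomial.aeval t P : ℝ) / Polynomial.aeval t Q = _
    exact (hred t (hQt t ht)).2
  have hQ₁ne : ∀ a ∈ Icc u v, (Polynomial.aeval a Q₁ : ℝ) ≠ 0 := fun a ha =>
    soloInformed_aeval_ne_zero_of_isCoprime_K hcop hQ₁0 huv ha hint
  /- Step 1: read `P₁/Q₁` as `Re(P₁/Q₁)` over `ℚ̄` and apply the algebraic piece lemma. -/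
  set PL := P₁.map soloInformedRealAlgHom with hPL
  set QL := Q₁.map soloInformedRealAlgHom with hQL
  have hQLne : ∀ t ∈ Icc u v,
      (QL.map (algebraMap (algebraicClosure ℚ ℂ) ℂ)).eval (t : ℂ) ≠ 0 := fun t ht => by
    rw [hQL, soloInformed_eval_map_realAlgHom]
    exact_mod_cast hQ₁ne t ht
  refine soloInformed_restrict_interval_mem_segSpan_alg r PL QL huv hu hv hQLne hI hsub
    fun z hz => ?_
  have hz' : z 0 ∈ Ioo u v := hz 0
  rw [hpq (hsub hz), hPL, hQL, soloInformed_algFun_map_realAlgHom]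
  show (Polynomial.aeval (z 0) P : ℝ) / Polynomial.aeval (z 0) Q = _
  exact (hred _ (hQt _ hz')).2

end Summit.KontsevichZagierPeriods.KontsevichZagierPeriods.Theorems
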